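import Summits.Schanuel.Schanuel.Theses.RigidCore
import Summits.Schanuel.Schanuel.Theorems.RigidCoreOneLogBranchRelationFiniteCore
import Literature.NumberTheory.Transcendental.BakerLogarithmsConclusion
import Literature.NumberTheory.Transcendental.LindemannWeierstrassProofs

/-!
# `RigidCore.OneLogBranchRelationFinite` (item stmt-Schanuel-0974, part 3/3)

What. For an algebraic `α ≠ 0` that is not a root of unity and `0 ≠ R ∈ ℚ̄[z, w]` with
`(z - w) ∤ R`, the set of `(j, k) ∈ ℤ²` with `R(log α + 2πi j, log α + 2πi k) = 0` is finite
(Lemma B1 of card period-lattice-rigidity-baker; the unconditional hinge of branch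
indiscernibility in route RigidCore).

How. `OneLogBranch.finite_branch_pairs` (part 2) with `K = ℚ̄ = algebraicClosure ℚ ℂ`, `E = ℂ`,
`L = log α`, `t = 2πi`. Its three hypotheses are discharged here from PROVED tree facts:
* `L ∉ ℚ̄ + ℚ̄·2πi` — Baker's theorem `Literature.NumberTheory.Transcendental.baker_holds`
  (Baker 1975, Thm 2.1) applied to `l = (log α, 2πi)`: `e^{log α} = α` and `e^{2πi} = 1` are
  algebraic, and `log α, 2πi` are `ℚ`-linearly independent exactly because `α` is not a root of
  unity (`algebraMap_add_mul_two_pi_I_ne_log`);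
* `2πi` transcendental over `ℚ̄` — Hermite–Lindemann `transcendental_exp_holds`: a nonzero
  algebraic `2πi` would make `e^{2πi} = 1` transcendental (`transcendental_two_pi_I`);
* `ℚ̄` relatively algebraically closed in `ℂ` — `isIntegral_trans` (the `ℚ`-algebra structures on
  `↥(algebraicClosure ℚ ℂ)` are realigned through `Subsingleton (Algebra ℚ _)`).

Sources: card period-lattice-rigidity-baker (B1); A. Baker, *Transcendental Number Theory* (1975),
Thm 2.1 [BakerTNT1975]; Lindemann 1882 [Lindemann1882]. Mathlib + tree only, no definitions.
-/

-- `Summit.Schanuel.Schanuel` (summit = problem) trips core's duplicate-namespace linter.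
set_option linter.dupNamespace false

namespace Summit.Schanuel.Schanuel.Theorems

open MvPolynomial Complex Literature.NumberTheory.Transcendental

/-- `2πi ≠ 0`. -/
theorem OneLogBranch.two_pi_I_ne_zero : (2 * (Real.pi : ℂ) * I) ≠ 0 := by
  simp [Real.pi_ne_zero, I_ne_zero]

/-- `ℚ̄ = algebraicClosure ℚ ℂ` is algebraic over `ℚ` also for the canonical `ℚ`-algebra structure
`DivisionRing.toRatAlgebra` (realigned from `algebraicClosure.isAlgebraic` through
`Subsingleton (Algebra ℚ _)`). -/
theorem OneLogBranch.isAlgebraic_rat_algebraicClosure :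
    Algebra.IsAlgebraic ℚ (algebraicClosure ℚ ℂ) := by
  have h := algebraicClosure.isAlgebraic ℚ ℂ
  have key : ∀ (i₁ i₂ : Algebra ℚ (algebraicClosure ℚ ℂ)), i₁ = i₂ →
      @Algebra.IsAlgebraic ℚ _ _ _ i₁ → @Algebra.IsAlgebraic ℚ _ _ _ i₂ := by
    rintro i₁ _ rfl h
    exact h
  exact key _ _ (Subsingleton.elim _ _) h

/-- `2πi` is transcendental over the field `ℚ̄ ⊂ ℂ` of algebraic numbers (Hermite–Lindemann:
`e^{2πi} = 1` is algebraic, so `2πi` cannot be a nonzero algebraic number). -/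
theorem OneLogBranch.transcendental_two_pi_I :
    Transcendental (algebraicClosure ℚ ℂ) (2 * (Real.pi : ℂ) * I) := by
  intro halg
  haveI := isAlgebraic_rat_algebraicClosure
  have hQ : IsAlgebraic ℚ (2 * (Real.pi : ℂ) * I) :=
    (isIntegral_trans (R := ℚ) _ halg.isIntegral).isAlgebraic
  have h1 := transcendental_exp_holds hQ two_pi_I_ne_zero
  rw [Complex.exp_two_pi_mul_I] at h1
  exact h1 isAlgebraic_one

/-- `ℚ̄` is relatively algebraically closed in `ℂ`. -/
theorem OneLogBranch.exists_algebraMap_eq_of_isAlgebraic (u : ℂ)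
    (hu : IsAlgebraic (algebraicClosure ℚ ℂ) u) :
    ∃ a : algebraicClosure ℚ ℂ, algebraMap (algebraicClosure ℚ ℂ) ℂ a = u := by
  haveI := isAlgebraic_rat_algebraicClosure
  have hint : IsIntegral ℚ u := isIntegral_trans (R := ℚ) _ hu.isIntegral
  have hmem : u ∈ algebraicClosure ℚ ℂ := mem_algebraicClosure_iff.mpr hint.isAlgebraic
  exact ⟨⟨u, hmem⟩, rfl⟩

/-- **Baker input.** For algebraic `α ≠ 0` that is not a root of unity, `log α ∉ ℚ̄ + ℚ̄·2πi`:
`1, log α, 2πi` are `ℚ̄`-linearly independent by Baker's theorem (`baker_holds`), the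
`ℚ`-independence of `log α, 2πi` being exactly the non-torsion hypothesis on `α`. -/
theorem OneLogBranch.algebraMap_add_mul_two_pi_I_ne_log {α : ℂ} (hα : IsAlgebraic ℚ α)
    (hα0 : α ≠ 0) (hroot : ∀ n : ℕ, 0 < n → α ^ n ≠ 1) (a c : algebraicClosure ℚ ℂ) :
    algebraMap (algebraicClosure ℚ ℂ) ℂ a + algebraMap (algebraicClosure ℚ ℂ) ℂ c *
      (2 * (Real.pi : ℂ) * I) ≠ Complex.log α := by
  intro heq
  set t : ℂ := 2 * (Real.pi : ℂ) * I with ht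
  set L : ℂ := Complex.log α with hL
  have ht0 : t ≠ 0 := two_pi_I_ne_zero
  -- `log α` and `2πi` are linearly independent over `ℚ`
  have hli : LinearIndependent ℚ ![L, t] := by
    rw [LinearIndependent.pair_iff]
    intro s r hsr
    by_cases hs : s = 0
    · subst hs
      simp only [zero_smul, zero_add] at hsr
      refine ⟨rfl, ?_⟩
      by_contra hr
      exact ht0 ((smul_eq_zero_iff_right hr).mp hsr)
    · exfalso
      set q : ℚ := -(r / s) with hq
      have hLq : L = (q : ℂ) * t := by
        have hsC : (s : ℂ) ≠ 0 := by exact_mod_cast hs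
        have h1 : (s : ℂ) * L + (r : ℂ) * t = 0 := by
          simpa [Rat.smul_def] using hsr
        rw [hq]
        push_cast
        field_simp
        linear_combination h1
      apply hroot q.den q.den_pos
      have h2 : α ^ q.den = Complex.exp ((q.den : ℂ) * L) := by
        rw [Complex.exp_nat_mul, hL, Complex.exp_log hα0]
      rw [h2, hLq, ← mul_assoc]
      have h3 : ((q.den : ℂ) * (q : ℂ)) = (q.num : ℂ) := by
        have := Rat.mul_den_eq_num q
        rw [mul_comm]
        exact_mod_cast this
      rw [h3, Complex.exp_int_mul, ht, Complex.exp_two_pi_mul_I, one_zpow]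
  have halg : ∀ i, IsAlgebraic ℚ (Complex.exp (![L, t] i)) := by
    intro i
    fin_cases i
    · simpa [hL, Complex.exp_log hα0] using hα
    · simp [ht, Complex.exp_two_pi_mul_I, isAlgebraic_one]
  have hB := baker_holds ![L, t] halg hli
  rw [Fintype.linearIndependent_iff] at hB
  have key := hB (fun o => o.elim a ![-1, c]) ?_ (some 0)
  · simp at key
  · rw [Fintype.sum_option, Fin.sum_univ_two]
    simp only [Option.elim_none, Option.elim_some, Matrix.cons_val_zero, Matrix.cons_val_one,
      Matrix.cons_val_fin_one, Algebra.smul_def, map_neg, map_one, mul_one]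
    linear_combination heq

/-- **Item stmt-Schanuel-0974** (`RigidCore.OneLogBranchRelationFinite`, Lemma B1 of card
period-lattice-rigidity-baker): for algebraic `α ≠ 0` not a root of unity and
`0 ≠ R ∈ ℚ̄[z, w]` not divisible by `z - w`, only finitely many pairs of branches
`(log α + 2πi j, log α + 2πi k)`, `(j, k) ∈ ℤ²`, satisfy `R = 0`. Unconditional: the inputs are
Baker's theorem (`baker_holds`) and Hermite–Lindemann (`transcendental_exp_holds`), both proved
in the tree; the algebra is `OneLogBranch.finite_branch_pairs`. -/
theorem oneLogBranchRelationFinite_proof :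
    Summit.Schanuel.Schanuel.Theses.RigidCore.OneLogBranchRelationFinite := by
  intro α hα hα0 hroot R hR hdiv
  exact OneLogBranch.finite_branch_pairs (K := algebraicClosure ℚ ℂ) (E := ℂ)
    (L := Complex.log α) (t := 2 * (Real.pi : ℂ) * I)
    (OneLogBranch.algebraMap_add_mul_two_pi_I_ne_log hα hα0 hroot)
    OneLogBranch.transcendental_two_pi_I OneLogBranch.exists_algebraMap_eq_of_isAlgebraic hR hdiv

end Summit.Schanuel.Schanuel.Theorems
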